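import Literature.NumberTheory.GaloisRepresentations.SemiLocalUnitGroupUnramifiedH1
import Literature.NumberTheory.GaloisRepresentations.CompletionRestrictionRange
import Literature.NumberTheory.GaloisRepresentations.LocalUnramifiedNormGroups
import Literature.NumberTheory.Automorphic.AdicCompletionLocalField
import HarnessLib

/-!
# The bridge from the completion `E_w` to the embedded local layer `F_v(E) ⊆ F̄_v`:
# `F_v(E) ≃ₐ[F_v] E_w` for every `w ∣ v`, `Hⁿ(Gal(E/F), ∏_{w∣v} E_wˣ) ≅ Hⁿ(Gal(F_v(E)/F_v), F_v(E)ˣ)`,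
# and the units of valuation zero correspond (Cassels–Fröhlich II §10, VII §1.1; Harari §13.1)

Topic `NumberTheory/GaloisRepresentations`; namespace `Literature.NumberTheory.GaloisRepresentations.SemiLocal`.
One definition with body (`compositumAlgEquivPlace`, a CHOICE from the tree's existence theorem
`SemiLocal.exists_bijective_algHom_compositum_place`), an abbreviation (`compositum`), two derived
definitions (a group isomorphism, a cohomology isomorphism) and theorems; NO named fact, no `sorry`, no
instance; number fields in `Type`.

Why.  The semi-local Shapiro chain (`SemiLocalShapiro` … `SemiLocalTateShapiro`) lands on the Galois
cohomology of the COMPLETION `E_w/F_v` (`Rep.ofAlgebraAutOnUnits F_v E_w`), while the tree's local class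
field theory in class-formation currency (door-c6's `LocalCyclicLayerClassModule`, `LocalUnitsValuationRep`,
the Weil-datum files `LocalUnramifiedNormGroups` …) is written for EMBEDDED layers
`L : IntermediateField F_v (AlgebraicClosure F_v)` of the local field `F_v`, with units of valuation zero
cut out by `LocalWeilDatum.tVal F_v L a = ord_{F_v}(N_{L/F_v} a) = 0`.  The compositum
`F_v(E) = F_v · ιE(E) ⊆ F̄_v` (`CompletionCompositum.lean`, Cassels–Fröhlich II §10 "`L_w = K_v L`") is such
a layer, `F_v`-isomorphic to `E_w` for every `w ∣ v`; this file names the isomorphism and transports.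

## What is formalised (`F E : Type`, `[IsGalois F E]`, `ιE : E →ₐ[F] F̄`, `w : Place F E v`)

* `compositum ιE v` — the tree's `IntermediateField.adjoin F_v (range (F̄ → F̄_v ∘ ιE))` (abbreviation);
  **`compositumAlgEquivPlace ιE w : compositum ιE v ≃ₐ[F_v] E_w`** (choice of the bijective `F_v`-algebra
  map of `exists_bijective_algHom_compositum_place`); `isGalois_compositum`; `autCompositumMulEquivStabilizer :
  Gal(F_v(E)/F_v) ≃* G_w` (via `autCongr` and `decompMulEquiv`).
* **`groupCohomologyUnitsRepIsoCompositum ιE w n : Hⁿ(Gal(E/F), ∏_{w∣v} E_wˣ) ≅ Hⁿ(Gal(F_v(E)/F_v), F_v(E)ˣ)`**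
  (`groupCohomologyUnitsRepIsoOfAlgEquiv`), `natCard_…`.
* valuations: `withZero_pow_eq_one_iff` (plumbing in `ℤᵐ⁰`), **`valued_norm_eq_one_iff`**
  (`v_v(N_{E_w/F_v} u) = 1 ↔ v_w(u) = 1`: `v_w ∘ algebraMap = v_v^{e}`, `N = ∏_σ σ`, the `σ` are isometries),
  **`tVal_compositumAlgEquivPlace_symm_eq_zero_iff`** (`t(e⁻¹ u) = 0 ↔ u ∈ 𝒪_wˣ`): the transport identifies
  door-c6's units of valuation zero (`ker unitsValuation`) with `placeUnitGroup w`.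

## References
* J. W. S. Cassels, A. Fröhlich (eds.), *Algebraic Number Theory* (1967), Ch. II §10 (`L ⊗_K K_v ≅ ∏ L_w`,
  `L_w = K_v L`), Ch. VII (Tate) §1.1. [CasselsFrohlichANT1967]
* D. Harari, *Galois Cohomology and Class Field Theory*, Springer (2020), §13.1 (the convention `K_v := i_v(K) k_v`,
  "the completion of `K` at `v^•`"). [Harari2020]
* J.-P. Serre, *Local Fields*, GTM 67 (1979), Ch. II §2 Cor. 4 ("For every `x ∈ L`, `w(x) = (1/f)v(N_{L/K}(x))`").
  [SerreLocalFields1979]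
-/

noncomputable section

open NumberField IsDedekindDomain CategoryTheory CategoryTheory.Limits Field
open Literature.NumberTheory.Automorphic

namespace Literature.NumberTheory.GaloisRepresentations

namespace SemiLocal

variable {F : Type} [Field F] [NumberField F] {E : Type} [Field E] [NumberField E] [Algebra F E]
variable {v : HeightOneSpectrum (𝓞 F)} [IsGalois F E] (ιE : E →ₐ[F] AlgebraicClosure F)

/-! ## §1. `F_v(E) ≃ₐ[F_v] E_w` and the cohomology transport -/

/-- **The compositum `F_v(E) ⊆ F̄_v`** of `F_v` and the image of `E` under `F̄ → F̄_v ∘ ιE` (the tree's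
expression of `CompletionCompositum.lean`, abbreviated; Harari's `K_v := i_v(K) k_v`).
[cite: CasselsFrohlichANT1967, Ch. II §10] -/
abbrev compositum (v : HeightOneSpectrum (𝓞 F)) :
    IntermediateField (v.adicCompletion F) (AlgebraicClosure (v.adicCompletion F)) :=
  IntermediateField.adjoin (v.adicCompletion F)
    (Set.range ((absClosureEmbedding F (v.adicCompletion F)).comp ιE))

/-- **`F_v(E) ≃ₐ[F_v] E_w` for every place `w ∣ v`** (a choice of the bijective `F_v`-algebra map of
`exists_bijective_algHom_compositum_place`: Cassels–Fröhlich II §10 "`L_w = K_v L`" for every `w`, by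
transport along `Gal(E/F)`). [cite: CasselsFrohlichANT1967, Ch. II §10] -/
def compositumAlgEquivPlace (w : Place F E v) :
    compositum ιE v ≃ₐ[v.adicCompletion F] (w : HeightOneSpectrum (𝓞 E)).adicCompletion E :=
  AlgEquiv.ofBijective (Classical.choose (exists_bijective_algHom_compositum_place v ιE w))
    (Classical.choose_spec (exists_bijective_algHom_compositum_place v ιE w))

/-- **`F_v(E)/F_v` is Galois** (transport of `isGalois_place`). [cite: CasselsFrohlichANT1967, Ch. VII §1.1] -/
theorem isGalois_compositum (w : Place F E v) : IsGalois (v.adicCompletion F) (compositum ιE v) :=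
  haveI := isGalois_place (F := F) w
  IsGalois.of_algEquiv (compositumAlgEquivPlace ιE w).symm

/-- **`Gal(F_v(E)/F_v) ≃* G_w`** (`autCongr` of the isomorphism, then `decompMulEquiv`).
[cite: CasselsFrohlichANT1967, Ch. VII §1.1] -/
def autCompositumMulEquivStabilizer (w : Place F E v) :
    (compositum ιE v ≃ₐ[v.adicCompletion F] compositum ιE v) ≃* MulAction.stabilizer (E ≃ₐ[F] E) w :=
  ((compositumAlgEquivPlace ιE w).autCongr).trans (decompMulEquiv w).symm

/-- **`Hⁿ(Gal(E/F), ∏_{w ∣ v} E_wˣ) ≅ Hⁿ(Gal(F_v(E)/F_v), F_v(E)ˣ)`**: the semi-local cohomology in the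
currency of the embedded local layer (Shapiro `groupCohomologyUnitsRepIsoAut` followed by the transport
`groupCohomologyAutOnUnitsIsoOfAlgEquiv`). [cite: Harari2020, §13.1 Prop. 13.1 (b)] -/
def groupCohomologyUnitsRepIsoCompositum (w : Place F E v) (n : ℕ) :
    groupCohomology (unitsRep F E v) n ≅
      groupCohomology (Rep.ofAlgebraAutOnUnits (v.adicCompletion F) (compositum ιE v)) n :=
  groupCohomologyUnitsRepIsoOfAlgEquiv w (compositumAlgEquivPlace ιE w).symm n

/-- `|Hⁿ(Gal(E/F), ∏_{w∣v} E_wˣ)| = |Hⁿ(Gal(F_v(E)/F_v), F_v(E)ˣ)|`. [cite: Harari2020, §13.1 Prop. 13.1 (b)] -/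
theorem natCard_groupCohomology_unitsRep_eq_compositum (w : Place F E v) (n : ℕ) :
    Nat.card (groupCohomology (unitsRep F E v) n) =
      Nat.card (groupCohomology (Rep.ofAlgebraAutOnUnits (v.adicCompletion F) (compositum ιE v)) n) :=
  Nat.card_congr (groupCohomologyUnitsRepIsoCompositum ιE w n).toLinearEquiv.toEquiv

/-! ## §2. Valuations: `t(e⁻¹ u) = 0 ↔ u ∈ 𝒪_wˣ` -/

omit [NumberField F] [NumberField E] [IsGalois F E] in
/-- In `ℤᵐ⁰` a non-zero element with a trivial positive power is trivial (`x = exp a`, `exp` injective,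
`ℤ` torsion-free). [cite: SerreLocalFields1979, Ch. II §2] -/
theorem withZero_pow_eq_one_iff {x : WithZero (Multiplicative ℤ)} (hx : x ≠ 0) {n : ℕ} (hn : n ≠ 0) :
    x ^ n = 1 ↔ x = 1 := by
  rw [← WithZero.exp_log hx, ← WithZero.exp_nsmul, WithZero.exp_eq_one, WithZero.exp_eq_one, smul_eq_zero]
  exact ⟨fun h => h.resolve_left hn, fun h => Or.inr h⟩

/-- **`v_v(N_{E_w/F_v} u) = 1 ↔ v_w(u) = 1`** for a unit `u` of `E_w` (`E/F` Galois): in `E_w`,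
`v_w(N u) = v_v(N u)^{e(w|v)}` (`valued_adicCompletionOfLiesOver`) and `N u = ∏_σ σ u` over
`Gal(E_w/F_v)` (`Algebra.norm_eq_prod_automorphisms`, `isGalois_place`) with every `σ` an isometry
(`valued_algEquiv_place`), so `v_v(N u)^e = v_w(u)^{[E_w:F_v]}`. [cite: SerreLocalFields1979, Ch. II §2 Cor. 4] -/
theorem valued_norm_eq_one_iff (w : Place F E v) (u : ((w : HeightOneSpectrum (𝓞 E)).adicCompletion E)ˣ) :
    Valued.v (Algebra.norm (v.adicCompletion F) (u : (w : HeightOneSpectrum (𝓞 E)).adicCompletion E)) = 1 ↔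
      Valued.v (u : (w : HeightOneSpectrum (𝓞 E)).adicCompletion E) = 1 := by
  haveI := finiteDimensional_place (K := F) w
  haveI := isGalois_place (F := F) w
  have h1 : Valued.v (algebraMap (v.adicCompletion F) ((w : HeightOneSpectrum (𝓞 E)).adicCompletion E)
      (Algebra.norm (v.adicCompletion F) (u : (w : HeightOneSpectrum (𝓞 E)).adicCompletion E))) =
      Valued.v (Algebra.norm (v.adicCompletion F) (u : (w : HeightOneSpectrum (𝓞 E)).adicCompletion E)) ^
        v.asIdeal.ramificationIdx' (w : HeightOneSpectrum (𝓞 E)).asIdeal := by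
    rw [algebraMap_place_eq, valued_adicCompletionOfLiesOver]
  have h2 : Valued.v (algebraMap (v.adicCompletion F) ((w : HeightOneSpectrum (𝓞 E)).adicCompletion E)
      (Algebra.norm (v.adicCompletion F) (u : (w : HeightOneSpectrum (𝓞 E)).adicCompletion E))) =
      Valued.v (u : (w : HeightOneSpectrum (𝓞 E)).adicCompletion E) ^
        Fintype.card ((w : HeightOneSpectrum (𝓞 E)).adicCompletion E ≃ₐ[v.adicCompletion F]
          (w : HeightOneSpectrum (𝓞 E)).adicCompletion E) := by
    rw [Algebra.norm_eq_prod_automorphisms, map_prod]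
    simp_rw [valued_algEquiv_place]
    rw [Finset.prod_const, Finset.card_univ]
  have he : v.asIdeal.ramificationIdx' (w : HeightOneSpectrum (𝓞 E)).asIdeal ≠ 0 :=
    Ideal.IsDedekindDomain.ramificationIdx'_ne_zero_of_liesOver _ v.ne_bot
  have hn : Fintype.card ((w : HeightOneSpectrum (𝓞 E)).adicCompletion E ≃ₐ[v.adicCompletion F]
      (w : HeightOneSpectrum (𝓞 E)).adicCompletion E) ≠ 0 := Fintype.card_ne_zero
  have hN0 : Valued.v (Algebra.norm (v.adicCompletion F) (u : (w : HeightOneSpectrum (𝓞 E)).adicCompletion E)) ≠ 0 :=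
    (Valuation.ne_zero_iff _).mpr (Algebra.norm_ne_zero_iff.mpr u.ne_zero)
  rw [← withZero_pow_eq_one_iff hN0 he, ← h1, h2, withZero_pow_eq_one_iff (valued_units_ne_zero w u) hn]

/-- **The transport carries the units of valuation zero of `F_v(E)` onto `𝒪_wˣ`**: for a unit `u` of `E_w`
and the `F_v`-isomorphism `e = compositumAlgEquivPlace ιE w`,
`t(e⁻¹ u) = ord_{F_v}(N_{F_v(E)/F_v}(e⁻¹ u)) = 0 ↔ u ∈ 𝒪_wˣ` (the tree's `LocalWeilDatum.tVal`, whose zero-set is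
door-c6's `ker unitsValuation`; `N` is invariant under `F_v`-isomorphisms, `Algebra.norm_eq_of_algEquiv`;
`ord = 0 ↔ |·| = 1`, `LocalWeilDatum.ord_eq_zero_iff`; the two valuations of `F_v` agree on "`= 1`").
[cite: SerreLocalFields1979, Ch. II §2 Cor. 4][cite: Harari2020, §13.1 (the groups `U_{K,w}`)] -/
theorem tVal_compositumAlgEquivPlace_symm_eq_zero_iff (w : Place F E v)
    (u : ((w : HeightOneSpectrum (𝓞 E)).adicCompletion E)ˣ) :
    LocalWeilDatum.tVal (v.adicCompletion F) (compositum ιE v)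
        ((compositumAlgEquivPlace ιE w).symm (u : (w : HeightOneSpectrum (𝓞 E)).adicCompletion E)) = 0 ↔
      u ∈ placeUnitGroup w := by
  haveI := finiteDimensional_place (K := F) w
  rw [mem_placeUnitGroup_iff, LocalWeilDatum.tVal, Algebra.norm_eq_of_algEquiv,
    LocalWeilDatum.ord_eq_zero_iff _ (Algebra.norm_ne_zero_iff.mpr u.ne_zero),
    (ValuativeRel.isEquiv (ValuativeRel.valuation (v.adicCompletion F))
      (Valued.v : Valuation (v.adicCompletion F) (WithZero (Multiplicative ℤ)))).eq_one_iff_eq_one,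
    valued_norm_eq_one_iff]

end SemiLocal

end Literature.NumberTheory.GaloisRepresentations

end
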